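import Literature.AlgebraicGeometry.Resolution.PrimeDivisorIdeals
import Literature.AlgebraicGeometry.Resolution.MonomialOrderReductionUnit
import Literature.AlgebraicGeometry.Resolution.MarkedIdeals
import HarnessLib

/-!
# [OURS · L1 W4.5(b) · EL♮] T-PRINC — the principal-ideal clause of the (TC) step: the reduced ideal of a codimension-one
# irreducible closed set is principal near every point at which the ambient is regular

Crux `EquisingularLiftNat` = stmt-ResolutionOfSingularities-20038 / child `EquisingularLiftNatThree` = stmt-…-20148 (route
EquisingularLift), line `sections`, registered stub `stub_elnat_tcDeltaPointResolution` (skeleton v5.1/v6); helper file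
`--supports stmt-ResolutionOfSingularities-20148 --as helper` (res-L1-w45b-stub-2 g4, own initiative, OFFER 2026-08-27T09:10:36Z). The (TC)
constructor of the registered stub asks its USER, at the blown-up point `x` of the stage `F₁` and for the chosen closed set `W ∋ x`,
for `∃ U : F₁.affineOpens, x ∈ U ∧ ((vanishingIdeal ⟨closure W, _⟩).ideal U).IsPrincipal`. This file discharges that clause
GENERICALLY when `closure W` is irreducible of codimension one (its generic point `ζ` has `coheight ζ = 1`) and `𝒪_{F₁,x}` is a
regular local ring (the good-point clause of the same step) — e.g. `W` = the running strict transform of the hypersurface.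
HONEST FRAMING: OURS (cell res-hironaka, slot W4.5(b)); NOT a statement of any manuscript; standard commutative algebra
(Auslander–Buchsbaum + Nakayama spreading). AI-written, weaker than expert review. No `sorry`; standard axioms.

## Content (namespace `…Cruxes.EquisingularLiftNat.Sections`) — `X` locally Noetherian, no integrality / regularity of `X` assumed

* `exists_affineOpens_isPrincipal_of_stalkIdeal_eq_span` — if the stalk `I_x` of an ideal sheaf is principal, `I(U)` is principal on
  some affine open `U ∋ x` (Nakayama: a generator may be taken among the germs of sections, tree
  `exists_mem_span_singleton_eq_of_span_eq`; spreading, tree `exists_ideal_eq_span_singleton_of_stalkIdeal_eq`).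
* `exists_affineOpens_isPrincipal_of_not_mem_support` — off `supp I` (there `I_x = 𝒪_{X,x}`).
* `exists_affineOpens_isPrincipal_primeDivisorIdeal` — **`𝓘_{cl ζ}` is principal near `x`** for `ζ ⤳ x` of codimension one and
  `𝒪_{X,x}` regular (factorial by Auslander–Buchsbaum, tree `IsRegularLocalRing.uniqueFactorizationMonoid`; height-one primes of a
  factorial domain are principal, tree `exists_prime_primeOfSpecializes_eq_span`).
* `exists_affineOpens_isPrincipal_vanishingIdeal_closure` — **the (TC) clause verbatim**: for ANY `W ⊆ X` whose closure has a generic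
  point `ζ` of codimension one and any `x` with `𝒪_{X,x}` regular, `∃ U : X.affineOpens, x ∈ U ∧ ((vanishingIdeal ⟨closure W, _⟩).ideal U).IsPrincipal`.
* `coheight_eq_of_isBlowup_of_not_mem_support` — codimension is unchanged off the centre of a blowing up (the generic point of the
  running strict transform keeps codimension one from step to step).

References: Matsumura, *Commutative Ring Theory*, Thm. 20.3; Görtz–Wedhorn I, Prop. B.75 (2), Thm. 11.40; Stacks 01WS, 02OS — through
the cited tree files (PrimeDivisorIdeals.lean, AlterationsBoundaryDivisor.lean, RegularLocalRingsUFD.lean).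
-/

set_option linter.dupNamespace false -- mandated namespace `Summit.<Summit>.<Problem>` of this single-conjunct summit

noncomputable section

open CategoryTheory AlgebraicGeometry TopologicalSpace Topology IsLocalRing
open Literature.AlgebraicGeometry.Resolution
open AlgebraicGeometry.Scheme.IdealSheafData

namespace Summit.ResolutionOfSingularities.ResolutionOfSingularities.Cruxes.EquisingularLiftNat.Sections

universe u

variable {X : Scheme.{u}} [IsLocallyNoetherian X]

/-- **A stalkwise principal ideal sheaf is principal on an affine neighbourhood.** If `I_x = (g)` then `I(U)` is principal for
some affine open `U ∋ x`. [cite: StacksProject, Tag 01WS] -/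
theorem exists_affineOpens_isPrincipal_of_stalkIdeal_eq_span (I : X.IdealSheafData) {x : X} {g : X.presheaf.stalk x}
    (hIg : stalkIdeal I x = Ideal.span {g}) :
    ∃ U : X.affineOpens, x ∈ (U : X.Opens) ∧ (I.ideal U).IsPrincipal := by
  classical
  obtain ⟨U, hU, hxU, -⟩ :=
    exists_isAffineOpen_mem_and_subset (X := X) (x := x) (U := ⊤) (Opens.mem_top x)
  -- a section `i ∈ I(U)` whose germ generates `I_x`
  obtain ⟨i, hi, hIi⟩ : ∃ i ∈ I.ideal ⟨U, hU⟩, stalkIdeal I x = Ideal.span {(X.presheaf.germ U x hxU).hom i} := by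
    by_cases hg0 : g = 0
    · refine ⟨0, Ideal.zero_mem _, ?_⟩
      rw [hIg, hg0, map_zero]
    · have hspan : Ideal.span ((X.presheaf.germ U x hxU).hom '' (I.ideal ⟨U, hU⟩)) = Ideal.span {g} := by
        rw [← hIg, stalkIdeal_eq_map_germ I ⟨U, hU⟩ hxU, Ideal.map]
      obtain ⟨_, ⟨i, hi, rfl⟩, hgen⟩ := exists_mem_span_singleton_eq_of_span_eq hg0 hspan
      exact ⟨i, hi, by rw [hgen, hIg]⟩
  obtain ⟨V, hVU, hxV, hIV⟩ := exists_ideal_eq_span_singleton_of_stalkIdeal_eq I ⟨U, hU⟩ hxU i hi hIi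
  exact ⟨V, hxV, ⟨_, by rw [hIV, Ideal.submodule_span_eq]⟩⟩

/-- Off the support an ideal sheaf is the unit ideal near the point, hence principal there. [folklore] -/
theorem exists_affineOpens_isPrincipal_of_not_mem_support (I : X.IdealSheafData) {x : X} (hx : x ∉ I.support) :
    ∃ U : X.affineOpens, x ∈ (U : X.Opens) ∧ (I.ideal U).IsPrincipal := by
  have htop : stalkIdeal I x = ⊤ := by
    by_contra h
    exact hx ((mem_support_iff_stalkIdeal_le I x).mpr (IsLocalRing.le_maximalIdeal h))
  exact exists_affineOpens_isPrincipal_of_stalkIdeal_eq_span I (g := 1) (by rw [htop, Ideal.span_singleton_one])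

/-- **T-PRINC for a prime divisor**: for a specialisation `ζ ⤳ x` with `ζ` of codimension one (`coheight ζ = 1`) and `𝒪_{X,x}` a
regular local ring, the reduced ideal sheaf `𝓘_{cl ζ}` (`primeDivisorIdeal ζ`) is principal on some affine open `U ∋ x`:
`(𝓘_{cl ζ})_x = 𝔭_ζ` is a height-one prime of the factorial domain `𝒪_{X,x}` (Auslander–Buchsbaum), hence principal.
[cite: Matsumura1987, Thm. 20.3] [cite: GortzWedhorn2020, Prop. B.75 (2)] -/
theorem exists_affineOpens_isPrincipal_primeDivisorIdeal {ζ x : X} (h : ζ ⤳ x) (hζ : Order.coheight ζ = 1)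
    (hreg : IsRegularLocalRing (X.presheaf.stalk x)) :
    ∃ U : X.affineOpens, x ∈ (U : X.Opens) ∧ ((primeDivisorIdeal ζ).ideal U).IsPrincipal := by
  haveI := hreg
  haveI : IsDomain (X.presheaf.stalk x) := isDomain_of_isRegularLocalRing _
  haveI : UniqueFactorizationMonoid (X.presheaf.stalk x) := IsRegularLocalRing.uniqueFactorizationMonoid _
  obtain ⟨p, -, hp⟩ := exists_prime_primeOfSpecializes_eq_span h hζ
  exact exists_affineOpens_isPrincipal_of_stalkIdeal_eq_span (primeDivisorIdeal ζ)
    ((stalkIdeal_primeDivisorIdeal h).trans hp)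

/-- **T-PRINC, the (TC) clause verbatim.** Let `W ⊆ X` be any subset whose closure has a generic point `ζ` of codimension one, and
`x ∈ X` a point with `𝒪_{X,x}` regular. Then `∃ U : X.affineOpens, x ∈ U ∧ ((vanishingIdeal ⟨closure W, _⟩).ideal U).IsPrincipal`
(at points of `closure W` by the prime-divisor case, elsewhere the ideal is the unit ideal).
[cite: Matsumura1987, Thm. 20.3] [cite: GortzWedhorn2020, Thm. 11.40 (2)] -/
theorem exists_affineOpens_isPrincipal_vanishingIdeal_closure {W : Set X} {ζ : X} (hζ : IsGenericPoint ζ (closure W))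
    (hcodim : Order.coheight ζ = 1) (x : X) (hreg : IsRegularLocalRing (X.presheaf.stalk x)) :
    ∃ U : X.affineOpens, x ∈ (U : X.Opens) ∧
      ((vanishingIdeal (⟨closure W, isClosed_closure⟩ : Closeds X)).ideal U).IsPrincipal := by
  have hcl : (⟨closure W, isClosed_closure⟩ : Closeds X) = ⟨closure {ζ}, isClosed_closure⟩ := Closeds.ext hζ.symm
  rw [hcl]
  by_cases hx : x ∈ closure ({ζ} : Set X)
  · exact exists_affineOpens_isPrincipal_primeDivisorIdeal (specializes_iff_mem_closure.mpr hx) hcodim hreg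
  · refine exists_affineOpens_isPrincipal_of_not_mem_support _ ?_
    rwa [← SetLike.mem_coe, coe_support_vanishingIdeal]

omit [IsLocallyNoetherian X] in
/-- **Codimension persists off the centre of a blowing up**: for `π : X′ → X` a blowing up along `C` and `x′` with `π x′ ∉ supp C`,
`coheight x′ = coheight (π x′)` (the stalks are isomorphic, Stacks 02OS) — so the generic point of the running strict transform of
a codimension-one set keeps codimension one from step to step. [cite: StacksProject, Tag 02OS] -/
theorem coheight_eq_of_isBlowup_of_not_mem_support {X' : Scheme.{u}} {π : X' ⟶ X} {C : X.IdealSheafData}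
    (hπ : IsBlowup π C) {x' : X'} (hx' : π.base x' ∉ C.support) : Order.coheight x' = Order.coheight (π.base x') := by
  haveI : IsIso (π.stalkMap x') := hπ.isIso_stalkMap_of_not_mem_support hx'
  have h1 := ringKrullDim_stalk_eq_coheight x'
  have h2 := ringKrullDim_stalk_eq_coheight (π.base x')
  have h3 : ringKrullDim (X.presheaf.stalk (π.base x')) = ringKrullDim (X'.presheaf.stalk x') :=
    ringKrullDim_eq_of_ringEquiv (asIso (π.stalkMap x')).commRingCatIsoToRingEquiv
  rw [h1, h2] at h3
  exact_mod_cast h3.symm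

end Summit.ResolutionOfSingularities.ResolutionOfSingularities.Cruxes.EquisingularLiftNat.Sections

end
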